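import Literature.NumberTheory.Sieve.LuGoldbachExceptionalSet
import Literature.NumberTheory.Sieve.MontgomeryVaughan1975DensityProofs
import Literature.NumberTheory.Sieve.HardyLittlewoodProofs
import HarnessLib

/-!
# The exponent ladder of the Goldbach exceptional set: `E(x) ≪ x^σ`

Topic `Literature/NumberTheory/Sieve`. The tree's Goldbach exceptional-set counting function is
`Literature.NumberTheory.Sieve.goldbachExceptionalCount x = #{N ≤ x : N even, N ≥ 4, R(N) = 0}`
(parity.S15, `ParityWave0.lean`). Print records the size of the exceptional set as a single
exponent, `E(X) ≪ X^σ`; this file names that ladder once,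

* `GoldbachExcExponent σ := (E(x) : ℝ) =O[atTop] x^σ`,

so that its rungs can be cited rather than re-typed (the typing was proposed by the Parity ideation
cell, seats parity-ideate-p4 ROUND-1 §4 T2 and parity-ideate-p3 ROUND-16 §2, which restated the
same body in private namespaces), and relates it to everything the tree already holds:

* `σ = 1` is trivial (`GoldbachExcExponent.one`); monotonicity (`GoldbachExcExponent.mono`); a
  bounded exceptional set gives every `σ ≥ 0` (`.of_bounded`), in particular the Hardy–Littlewood
  Goldbach asymptotic (Conjecture A, `HardyLittlewoodGoldbach`) gives every `σ ≥ 0`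
  (`HardyLittlewoodGoldbach.goldbachExcExponent`);
* **Montgomery–Vaughan 1975** (PROVED in the tree, `goldbachExceptionalCount_isBigO_rpow_holds`):
  some `σ < 1` (`GoldbachExcExponent.exists_lt_one`);
* **Lu 2010** `σ = 0.879`: the tree's named fact `goldbachExceptionalCount_isBigO_rpow_lu` IS the
  rung `0.879` (`goldbachExcExponent_lu_iff`, `Iff.rfl`), and every rung `σ > 3/4` is exactly the
  major-arc input of the tree's Lu frame (`GoldbachExcExponent.of_majorArc`, from
  `goldbachExceptionalCount_isBigO_rpow_of_majorArc`);
* the two printed rungs BELOW `3/4`, which the Lu frame cannot express (its level is `≤ 1/4`) and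
  which rest on Pintz's explicit formula (arXiv:1804.05561) at level `X^{4/9−ε}`, are vendored as
  NAMED FACTS (not proved here), stated in the tree's currency:
  `Pintz2018_goldbachExceptionalSet` (`E(X) < X^{0.72}` for `X > X₂`, arXiv:1804.09084 Theorem 1)
  and `Zhao2025_goldbachExceptionalSet` (`E(X) = O(X^{0.709})`, arXiv:2511.05631 Theorem 1.1,
  preprint of November 2025). Both sources are arXiv preprints (not refereed at the time of
  writing); the constants are ineffective (Siegel). The printed `E(X)` counts the even `n ≤ X`
  that are not a sum of two primes (Pintz (1.1): `ℰ = {2 ∣ n; n ≠ p + p'}`; Zhao, Abstract), a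
  superset of the tree's exceptional set (which omits `n = 0, 2`), so each printed bound implies
  the bound stated here verbatim.

Everything called `theorem` below is proved (no `sorry`); the two `def … : Prop` rungs of Pintz
and Zhao are the only unproved statements.

## References (quoted from the materialised pages)

* [Pintz2018ExplicitFormulaII] J. Pintz, *A new explicit formula in the additive theory of primes
  with applications II. The exceptional set in Goldbach's problem*, arXiv:1804.09084 (2018), §1
  (1.1) `ℰ = {2 ∣ n; n ≠ p + p', p, p' ∈ 𝒫}`, `E(X) = |{n ≤ X; n ∈ ℰ}|`, and **Theorem 1**: "There
  is an ineffective constant `X₂` such that for `X > X₂`, `E(X) < X^{0.72}`."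
* [Zhao2025GoldbachLinnik] G. Zhao, *The exceptional set of Goldbach problem and Linnik's
  constant*, arXiv:2511.05631 (2025), Abstract: "Let `E(X)` be the number of even integers below
  `X` which are not a sum of two primes. We prove that `E(X) = O(X^{0.709})`"; §1 **Theorem 1.1**:
  "`E(X) = O(X^{0.709})`, where the implicit constant is ineffective", reduced (§2, "Theorem 1.1
  follows easily from Theorem 1.2") to a single-modulus zero-sum inequality, Theorem 1.2.
* [LuJNT2010] W. C. Lu, *Exceptional set of Goldbach number*, J. Number Theory 130 (2010)
  2359–2392, Theorem 1 (`0.879`; the tree's `goldbachExceptionalCount_isBigO_rpow_lu`).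
* [MontgomeryVaughanActa1975] H. L. Montgomery, R. C. Vaughan, *The exceptional set in Goldbach's
  problem*, Acta Arith. 27 (1975) 353–370, Theorem (`x^{1−δ}`; proved in the tree).
-/

noncomputable section

open Filter Finset Asymptotics

namespace Literature.NumberTheory.Sieve

/-! ### The ladder currency -/

/-- **`E(x) ≪ x^σ`**: the Goldbach exceptional set `E(x) = #{N ≤ x : N even, N ≥ 4, N ≠ p + p'}`
(the tree's `goldbachExceptionalCount`) is `O(x^σ)` as `x → ∞` through the natural numbers.
The rungs in print: `σ = 1 − δ` (Montgomery–Vaughan 1975, proved in the tree), `0.95`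
(Chen–Liu 1989), `0.921`, `0.914` (H. Z. Li 1999, 2000), `0.879` (Lu 2010), `0.72` (Pintz 2018),
`0.709` (Zhao 2025); `1/2 + ε` under GRH (Hardy–Littlewood 1924). The shape `E(X) ≪ X^{1−δ}` is
Montgomery–Vaughan's Theorem ((1.5) of Pintz's survey of the ladder, arXiv:1804.09084 §1).
[cite: MontgomeryVaughanActa1975, Theorem (the form `E(X) ≪ X^{1−δ}`)] -/
def GoldbachExcExponent (σ : ℝ) : Prop :=
  (fun x : ℕ => (goldbachExceptionalCount x : ℝ)) =O[atTop] fun x => (x : ℝ) ^ σ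

namespace GoldbachExcExponent

/-- Unfolding lemma. [cite: MontgomeryVaughanActa1975, Theorem (ladder bookkeeping for `E(X) ≪ X^{1−δ}`)] -/
theorem iff_isBigO (σ : ℝ) : GoldbachExcExponent σ ↔
    (fun x : ℕ => (goldbachExceptionalCount x : ℝ)) =O[atTop] fun x => (x : ℝ) ^ σ := Iff.rfl

/-- `E(x) ≪ x^σ` iff `E(x) ≤ C x^σ` for some `C` and all large `x` (both sides are nonnegative, so
the norms of `IsBigO` disappear). [cite: MontgomeryVaughanActa1975, Theorem (ladder bookkeeping for `E(X) ≪ X^{1−δ}`)] -/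
theorem iff_eventually_le (σ : ℝ) : GoldbachExcExponent σ ↔
    ∃ C : ℝ, ∀ᶠ x : ℕ in atTop, (goldbachExceptionalCount x : ℝ) ≤ C * (x : ℝ) ^ σ := by
  rw [GoldbachExcExponent, Asymptotics.isBigO_iff]
  refine ⟨fun ⟨C, hC⟩ => ⟨C, ?_⟩, fun ⟨C, hC⟩ => ⟨C, ?_⟩⟩
  · filter_upwards [hC] with x hx
    rwa [Real.norm_of_nonneg (Nat.cast_nonneg _),
      Real.norm_of_nonneg (Real.rpow_nonneg (Nat.cast_nonneg _) _)] at hx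
  · filter_upwards [hC] with x hx
    rwa [Real.norm_of_nonneg (Nat.cast_nonneg _),
      Real.norm_of_nonneg (Real.rpow_nonneg (Nat.cast_nonneg _) _)]

/-- A pointwise eventual bound `E(x) ≤ C x^σ` gives the rung `σ`. [cite: MontgomeryVaughanActa1975, Theorem (ladder bookkeeping for `E(X) ≪ X^{1−δ}`)] -/
theorem of_eventually_le {σ C : ℝ}
    (h : ∀ᶠ x : ℕ in atTop, (goldbachExceptionalCount x : ℝ) ≤ C * (x : ℝ) ^ σ) :
    GoldbachExcExponent σ :=
  (iff_eventually_le σ).2 ⟨C, h⟩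

/-- **Monotonicity of the ladder**: a smaller exponent is a stronger statement. [cite: MontgomeryVaughanActa1975, Theorem (ladder bookkeeping for `E(X) ≪ X^{1−δ}`)] -/
theorem mono {σ σ' : ℝ} (h : GoldbachExcExponent σ) (hle : σ ≤ σ') : GoldbachExcExponent σ' := by
  refine h.trans (Asymptotics.IsBigO.of_bound 1 ?_)
  filter_upwards [Filter.eventually_ge_atTop 1] with x hx
  have hx1 : (1 : ℝ) ≤ x := by exact_mod_cast hx
  rw [one_mul, Real.norm_of_nonneg (Real.rpow_nonneg (by linarith) _),
    Real.norm_of_nonneg (Real.rpow_nonneg (by linarith) _)]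
  exact Real.rpow_le_rpow_of_exponent_le hx1 hle

/-- The trivial rung `σ = 1`: `E(x) ≤ x + 1 ≤ 2x`. [cite: MontgomeryVaughanActa1975, Theorem (ladder bookkeeping for `E(X) ≪ X^{1−δ}`)] -/
theorem one : GoldbachExcExponent 1 := by
  refine Asymptotics.IsBigO.of_bound 2 ?_
  filter_upwards [Filter.eventually_ge_atTop 1] with x hx
  have hx1 : (1 : ℝ) ≤ x := by exact_mod_cast hx
  rw [Real.norm_of_nonneg (Nat.cast_nonneg _), Real.rpow_one, Real.norm_of_nonneg (by linarith)]
  have hE : goldbachExceptionalCount x ≤ x + 1 := by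
    unfold goldbachExceptionalCount
    exact (Finset.card_filter_le _ _).trans (Finset.card_range _).le
  calc (goldbachExceptionalCount x : ℝ) ≤ (x : ℝ) + 1 := by exact_mod_cast hE
    _ ≤ 2 * x := by linarith

/-- A BOUNDED exceptional set gives every rung `σ ≥ 0`. [cite: MontgomeryVaughanActa1975, Theorem (ladder bookkeeping for `E(X) ≪ X^{1−δ}`)] -/
theorem of_bounded (hB : ∃ B : ℕ, ∀ x : ℕ, goldbachExceptionalCount x ≤ B) {σ : ℝ}
    (hσ : 0 ≤ σ) : GoldbachExcExponent σ := by
  obtain ⟨B, hB⟩ := hB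
  refine Asymptotics.IsBigO.of_bound (B : ℝ) ?_
  filter_upwards [Filter.eventually_ge_atTop 1] with x hx
  have hx1 : (1 : ℝ) ≤ x := by exact_mod_cast hx
  rw [Real.norm_of_nonneg (Nat.cast_nonneg _),
    Real.norm_of_nonneg (Real.rpow_nonneg (by linarith) _)]
  calc (goldbachExceptionalCount x : ℝ) ≤ B := by exact_mod_cast hB x
    _ ≤ B * (x : ℝ) ^ σ := le_mul_of_one_le_right (Nat.cast_nonneg _) (Real.one_le_rpow hx1 hσ)

/-- **Montgomery–Vaughan 1975** on the ladder (a THEOREM of the tree,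
`goldbachExceptionalCount_isBigO_rpow_holds`): some rung `σ < 1` holds.
[cite: MontgomeryVaughanActa1975, Theorem] -/
theorem exists_lt_one : ∃ σ : ℝ, σ < 1 ∧ GoldbachExcExponent σ := by
  obtain ⟨δ, hδ, h⟩ := goldbachExceptionalCount_isBigO_rpow_holds
  exact ⟨1 - δ, by linarith, h⟩

/-- In the tree's Lu 2010 frame (minor arcs PROVED at every level `≤ 1/4`), a rung `σ` is exactly
the major-arc input `Lu2010.MajorArcLowerBoundOffSmallSet σ` (which forces `σ > 3/4`).
[cite: LuJNT2010, Theorem 1] -/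
theorem of_majorArc {σ : ℝ} (hB : Lu2010.MajorArcLowerBoundOffSmallSet σ) :
    GoldbachExcExponent σ :=
  goldbachExceptionalCount_isBigO_rpow_of_majorArc hB

end GoldbachExcExponent

/-- The tree's Lu fact (parity.S15, `E(x) ≪ x^{0.879}`) IS the rung `σ = 0.879`, definitionally.
[cite: LuJNT2010, Theorem 1] -/
theorem goldbachExcExponent_lu_iff :
    GoldbachExcExponent 0.879 ↔ goldbachExceptionalCount_isBigO_rpow_lu := Iff.rfl

/-- Under the **Hardy–Littlewood Goldbach asymptotic** (Conjecture A, the registered open statement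
`HardyLittlewoodGoldbach`) the exceptional set is finite
(`HardyLittlewoodGoldbach.exists_goldbachExceptionalCount_le`), hence every rung `σ ≥ 0` holds.
This is the Literature half of the on-path certificate "summit ⇒ rung" of the Parity ladder (the
summit side composes it with `GeneralizedHardyLittlewood → HardyLittlewoodGoldbach`).
[cite: HardyLittlewoodPN3, §4.1 Conjecture A (4.11)–(4.12) p. 32 (posed)] -/
theorem HardyLittlewoodGoldbach.goldbachExcExponent (h : HardyLittlewoodGoldbach) {σ : ℝ}
    (hσ : 0 ≤ σ) : GoldbachExcExponent σ :=
  GoldbachExcExponent.of_bounded h.exists_goldbachExceptionalCount_le hσ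

/-! ### The printed rungs below `3/4` (named facts, not proved here) -/

/-- **Pintz 2018, Theorem 1** (as printed, arXiv:1804.09084 §1): "There is an ineffective constant
`X₂` such that for `X > X₂`, `E(X) < X^{0.72}`", where `E(X) = |{n ≤ X; n ∈ ℰ}|`,
`ℰ = {2 ∣ n; n ≠ p + p', p, p' ∈ 𝒫}` ((1.1)). Stated for the tree's `goldbachExceptionalCount`,
which counts the subset `{4 ≤ N ≤ X : N even, N ≠ p + p'}` of Pintz's set, so the printed bound
gives this one verbatim; `X` is specialised to natural numbers (`E` is a step function). Source
status: arXiv preprint (v2 2021), part II of a series resting on the explicit formula of part I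
(arXiv:1804.05561, Theorem 1 = Theorem A here) with major arcs of level `P ≤ X^{4/9−ε}`; the
method's ceiling is `E(X) < X^{3/5+ε}` (Theorem B, the Siegel-zero case). Named fact, not proved
here: none of its inputs (Pintz's explicit formula, log-free density theorems, Heath-Brown /
Xylouris zero-repulsion tables) is in the tree. [cite: Pintz2018ExplicitFormulaII, Theorem 1] -/
def Pintz2018_goldbachExceptionalSet : Prop :=
  ∃ X₂ : ℝ, ∀ X : ℕ, X₂ < X → (goldbachExceptionalCount X : ℝ) < (X : ℝ) ^ (0.72 : ℝ)

/-- Pintz's theorem on the ladder: the rung `σ = 0.72`. [cite: Pintz2018ExplicitFormulaII, Theorem 1] -/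
theorem Pintz2018_goldbachExceptionalSet.goldbachExcExponent (h : Pintz2018_goldbachExceptionalSet) :
    GoldbachExcExponent 0.72 := by
  obtain ⟨X₂, hX₂⟩ := h
  refine GoldbachExcExponent.of_eventually_le (C := 1) ?_
  filter_upwards [Filter.eventually_gt_atTop ⌈X₂⌉₊] with X hX
  rw [one_mul]
  have hX' : X₂ < X := (Nat.le_ceil X₂).trans_lt (by exact_mod_cast hX)
  exact (hX₂ X hX').le

/-- **Zhao 2025, Theorem 1.1** (as printed, arXiv:2511.05631 §1): "`E(X) = O(X^{0.709})`, where
the implicit constant is ineffective", `E(X)` being "the number of even integers below `X` which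
are not a sum of two primes" (Abstract; §1 says "two odd primes", a set that is larger still).
Stated for the tree's `goldbachExceptionalCount` (a subset count, so the printed bound gives this
one). Source status: arXiv PREPRINT (v1, November 2025, 10 pp.), a refinement (`δ = 0.291`) of
Pintz's method (`δ = 0.28`): §2 reduces Theorem 1.1 to the single-modulus zero-sum inequality
Theorem 1.2 ("a two-dimensional version of Linnik's problem"), proved in §§3–5 by a six-case
analysis fed by Heath-Brown's (1992) and Xylouris's (2009/2011) zero-repulsion tables and Pintz's
log-free density bounds; the Parity ideation cell's pre-registered re-computation of that case
analysis is parity-ideate-p3 ROUND-16 (2026-08-28). Named fact, not proved here.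

AUDIT STATUS (this project; parity-ideate ROUND-16 «EXCSET-CERT», 2026-08-28, memo
`FINDINGS-P3-R16.md`, referee verdicts g66–g68; every number below is H1-conditional on the printed
inputs EG25 Lemma 2.1 / 3.1 / 3.3–3.4 = Pintz 2018 Thms C, D, J, EG25 "Thm 1.2 ⇒ Thm 1.1", and the
Heath-Brown 1992 / Xylouris 2009–2011 table rows as printed). (i) Reproduction: the engine of
§§3–5 reproduces to print precision (Cor 3.2: 6/6 constants to 0.05 %; Lemma 3.4: 11/11 to 0.5 %;
EG25's own parameters give `δ₀* = 0.29154`, i.e. slack 0.0005 at `δ = 0.291`). (ii) Located slips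
in the PRINTED PROOF: E16.1 — case (1) uses `h(e^{−3.08}) ≤ 0.951` whereas `h(e^{−3.08}) = 1.012`
(repairable from Heath-Brown 1992 Lemma 8.8, `sup h = 0.948`); E16.3/E16.4 — two row slips in
Cor 3.6 (label swap of the `1.273` rows; row `(1.311; .5, .92, .92)` prints `0.2920`, method gives
`0.2623`, conservative); E16.5 — the three "general" rows `0.2668 / 0.3487 / 0.3175` (cases 4a, 5a,
5b) apply Pintz's Theorem J with `λ₀` above the exceptional zero, outside its hypothesis (4.33)
(which requires `λ ≥ λ₀` for ALL zeros of all characters mod `q`); under the SAFE reading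
(`λ₀` = global floor) EG25's own six-case tree reaches only `δ = 0.29063 < 0.291` (case 5b total
`1.0104` at `δ = 0.291`). (iii) Outcome for the STATEMENT: re-celling the same argument over all 44
printed thresholds of the cited tables, under the SAFE reading, gives an interval-arithmetic
certificate `δ_cert = 0.2928 ≥ 0.291` (68/68 inequalities, worst `0.992678`; combination layer
re-checked in Lean, `LayerA16.lean`), so `E(X) ≪ X^{0.709}` is SUPPORTED — by a repaired,
re-celled version of the printed argument, not by the proof as printed; with EG25's convention the
certificate reaches `δ_cert = 0.2954` (exponent `0.7046`). (iv) Ceiling of the printed inputs: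
`δ ≥ 0.296` (exponent `0.704`) is NOT reachable from the cited tables (`sup δ = 0.2956`). The body
of this named fact is unchanged by the audit (statement as printed); no dependents rely on it.
[cite: Zhao2025GoldbachLinnik, Theorem 1.1] -/
def Zhao2025_goldbachExceptionalSet : Prop :=
  GoldbachExcExponent 0.709

/-- Zhao's rung implies Pintz's rung on the ladder (`0.709 ≤ 0.72`). [cite: Zhao2025GoldbachLinnik, Theorem 1.1] -/
theorem Zhao2025_goldbachExceptionalSet.goldbachExcExponent_pintz
    (h : Zhao2025_goldbachExceptionalSet) : GoldbachExcExponent 0.72 :=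
  GoldbachExcExponent.mono h (by norm_num)

/-- Either printed rung below `3/4` improves the tree's Lu rung `0.879`.
[cite: Pintz2018ExplicitFormulaII, Theorem 1] -/
theorem Pintz2018_goldbachExceptionalSet.lu (h : Pintz2018_goldbachExceptionalSet) :
    goldbachExceptionalCount_isBigO_rpow_lu :=
  goldbachExcExponent_lu_iff.1 (h.goldbachExcExponent.mono (by norm_num))

end Literature.NumberTheory.Sieve
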